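/-
Origin: expansion seat `planner-pub-hodgecm-pv14-g5-0`, handover #12 2026-08-18T11:06:55Z (`HOME/pub-hodgecm-pv14-g5/lean/Pv14g5/WeilThetaModelHeisenbergPs.lean`, md5 17c8ffa0, 504 lines);
landed by the gen-7 packager in gate run 28 as `HodgeCM/Automorphic/WeilThetaModelHeisenbergPs.lean` (import ^import Pv14g5\.→import HodgeCM.Automorphic. ×2).
-/
/-
Origin: HOME/pub-hodgecm-pv14-g5/lean/Pv14g5/WeilThetaModelHeisenbergPs.lean — session planner-pub-hodgecm-pv14-g5-0
(unit pub-hodgecm-pv14-g5, DAG-node prover #14 gen 5).  Intended final place: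
`HodgeCM/Automorphic/WeilThetaModelHeisenbergPs.lean` (namespace `HodgeCM.SchwartzWeil`).
PACKAGER: rewrite `import Pv14g5.WeilThetaModelHeisenbergAdjoin` to
`import HodgeCM.Automorphic.WeilThetaModelHeisenbergAdjoin` (this seat's HANDOVER #11) and
`import Pv14g5.SchwartzChirp` to `import HodgeCM.Automorphic.SchwartzChirp` (HANDOVER #10).
Asserts nothing (no `axiom`, no new constants).
-/
import Summits.HodgeConjecture.HodgeCM.Automorphic.WeilThetaModelHeisenbergAdjoin_2
import Summits.HodgeConjecture.HodgeCM.Automorphic.SchwartzChirp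
import Mathlib.SetTheory.Cardinal.Free

/-!
# The Heisenberg theta model with BOTH generators of `SL₂(ℤ)` adjoined: `σ ↦ 𝓕`, `u ↦ T_m`

Files #6/#8 adjoined the Weyl element `σ` (acting by the Fourier transform `𝓕`), file #10 constructed the
chirp `T_c : Φ ↦ 𝐞(c‖x‖²)Φ` and the unipotent automorphisms `u_t` of `Heis V` with
`T_{mt/2} ∘ ρ_m(h) = ρ_m(u_t h) ∘ T_{mt/2}`, and file #11 reduced "adjoin a discrete group `D` of intertwiners"
to four inputs per generator.  Here `D := FreeGroup PsGen` is the free group on the two symbols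
`PsGen.weyl, PsGen.unip`, acting on `Heis V` by `σ ↦ weylAut` (`(a,b,u) ↦ (m⁻¹b, -ma, u𝐞(⟨a,b⟩))`) and
`u ↦ u_2` (`(a,b,u) ↦ (a, b + 2a, u𝐞(-‖a‖²))`), and on `𝓢(V, ℂ)` by `σ ↦ 𝓕`, `u ↦ T_m`; the four inputs are
discharged from #6/#8/#10 by induction on the free group (`FreeGroup.induction_on`):

* `Heis.continuous_psAction`, `Heis.psAction_center` — continuity, centre fixed;
* `intertwines_psRep : ρ_m(ψ_g h) = π_g ρ_m(h) π_g⁻¹`;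
* `fixesTheta_psRep : Σ_{v ∈ L} (π_g Ψ)(v) = Σ_{v ∈ L} Ψ(v)` for a SELF-DUAL lattice `L = L*`
  (Poisson summation for `σ`, integrality `m‖v‖² ∈ ℤ` for `u`);
* `preservesArith_psAction : ψ_g(arith) = arith` for `L = L*`.

Consequently (`heisenbergPsModel`) prl1-g4's record `WeilThetaModel (Heis V ⋊ F⟨σ,u⟩) ⟨arith, σ, u⟩ U(1) Γ` with
every field a theorem, the adjoined elements acting by `𝓕` and `T_m` (`repP_weyl_apply`, `repP_unip_apply`) and
absorbed by the kernel (`heisenbergPsModel_θ_weyl_mul`, `heisenbergPsModel_θ_unip_mul`), non-degenerate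
(`heisenbergPsModel_θ_ne_zero`); the lattice junction `heisenbergPsLatticeModel : CocompactLatticeModel`; and the
standard instances on `ℝⁿ ⊃ ℤⁿ` (`heisenbergPsModelStd`, `heisenbergPsLatticeModelStd`).

HONEST SCOPE.  No relation of `SL₂(ℤ)` / `Mp₂(ℤ)` is imposed: the acting group is `Heis V ⋊ F₂` with `F₂` FREE on
`σ, u` (so this is a representation of a group SURJECTING onto the arithmetic metaplectic-type group generated
by `𝓕` and `T_m` inside `U(𝓢(V, ℂ))`, not a computation of that group); in particular the Weil index / eighth
root of unity in `(𝓕 T_1)³` is not computed here (Mathlib v4.32 has no Gaussian Schwartz function), the real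
one-parameter groups `t ↦ u_t`, `c ↦ T_c` are adjoined only at the integral points, and finite places are not
touched.  Every statement below is a kernel-checked theorem about Mathlib objects; nothing is cited.
-/

set_option autoImplicit false

noncomputable section

open Topology MeasureTheory
open scoped RealInnerProductSpace FourierTransform SchwartzMap

namespace HodgeCM
namespace SchwartzWeil

/-! ## 1. The two generator symbols and the free group on them as a discrete topological group -/

/-- The two generator symbols: the Weyl element `σ` and the unipotent `u`. -/
inductive PsGen
  | weyl
  | unip
  deriving DecidableEq

namespace PsGen

/-- An injection into `Bool` (used for countability). -/
def toBool : PsGen → Bool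
  | weyl => false
  | unip => true

/-- (Ported verbatim from the HodgeCMPerL package; no docstring in the source.) -/
theorem toBool_injective : Function.Injective toBool := by
  intro a b h
  cases a <;> cases b <;> simp_all [toBool]

/-- (Ported verbatim from the HodgeCMPerL package; no docstring in the source.) -/
instance : Countable PsGen := toBool_injective.countable

/-- (Ported verbatim from the HodgeCMPerL package; no docstring in the source.) -/
instance : TopologicalSpace (FreeGroup PsGen) := ⊥

/-- (Ported verbatim from the HodgeCMPerL package; no docstring in the source.) -/
instance : DiscreteTopology (FreeGroup PsGen) := ⟨rfl⟩

/-- (Ported verbatim from the HodgeCMPerL package; no docstring in the source.) -/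
instance : IsTopologicalGroup (FreeGroup PsGen) where
  continuous_mul := continuous_of_discreteTopology
  continuous_inv := continuous_of_discreteTopology

/-- (Ported verbatim from the HodgeCMPerL package; no docstring in the source.) -/
instance : LocallyCompactSpace (FreeGroup PsGen) := HeisSD.locallyCompactSpace_of_discrete _

end PsGen

/-! ## 2. The action `ψ : F⟨σ,u⟩ →* Aut(Heis V)` -/

namespace Heis

variable {V : Type*} [NormedAddCommGroup V] [InnerProductSpace ℝ V] (m : ℤ) (hm : m ≠ 0)

/-- The generators act by `σ ↦ weylAut m`, `u ↦ u_2`. -/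
def psGenAut : PsGen → MulAut (Heis V)
  | .weyl => weylAut m hm
  | .unip => unip 2

/-- (Ported verbatim from the HodgeCMPerL package; no docstring in the source.) -/
@[simp] theorem psGenAut_weyl : (psGenAut m hm PsGen.weyl : MulAut (Heis V)) = weylAut m hm := rfl

/-- (Ported verbatim from the HodgeCMPerL package; no docstring in the source.) -/
@[simp] theorem psGenAut_unip : (psGenAut m hm PsGen.unip : MulAut (Heis V)) = unip 2 := rfl

/-- **`ψ : FreeGroup PsGen →* MulAut (Heis V)`**, the universal extension. -/
def psAction : FreeGroup PsGen →* MulAut (Heis V) := FreeGroup.lift (psGenAut m hm)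

/-- (Ported verbatim from the HodgeCMPerL package; no docstring in the source.) -/
@[simp] theorem psAction_of (g : PsGen) : (psAction m hm (FreeGroup.of g) : MulAut (Heis V)) = psGenAut m hm g :=
  FreeGroup.lift_apply_of

/-- (Ported verbatim from the HodgeCMPerL package; no docstring in the source.) -/
theorem psAction_weyl : (psAction m hm (FreeGroup.of PsGen.weyl) : MulAut (Heis V)) = weylAut m hm := by
  rw [psAction_of, psGenAut_weyl]

/-- (Ported verbatim from the HodgeCMPerL package; no docstring in the source.) -/
theorem psAction_unip : (psAction m hm (FreeGroup.of PsGen.unip) : MulAut (Heis V)) = unip 2 := by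
  rw [psAction_of, psGenAut_unip]

/-- (Ported verbatim from the HodgeCMPerL package; no docstring in the source.) -/
theorem continuous_psGenAut (g : PsGen) : Continuous (psGenAut m hm g : Heis V → Heis V) := by
  cases g with
  | weyl => exact continuous_weyl m hm
  | unip => exact continuous_unip 2

/-- (Ported verbatim from the HodgeCMPerL package; no docstring in the source.) -/
theorem continuous_psGenAut_symm (g : PsGen) : Continuous fun h : Heis V => (psGenAut m hm g).symm h := by
  cases g with
  | weyl =>
    simp only [psGenAut_weyl, weylAut_symm_apply]
    exact (continuous_weyl m hm).comp ((continuous_weyl m hm).comp (continuous_weyl m hm))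
  | unip =>
    simp only [psGenAut_unip, unip_symm_apply]
    exact continuous_unipFun (-2)

/-- Every `ψ_g` is continuous. -/
theorem continuous_psAction (g : FreeGroup PsGen) : Continuous (psAction m hm g : Heis V → Heis V) := by
  induction g using FreeGroup.induction_on with
  | C1 =>
    rw [map_one, MulAut.coe_one]
    exact continuous_id
  | of x =>
    rw [psAction_of]
    exact continuous_psGenAut m hm x
  | inv_of x _ =>
    rw [map_inv, psAction_of, MulAut.inv_def]
    exact continuous_psGenAut_symm m hm x
  | mul x y hx hy =>
    rw [map_mul, MulAut.coe_mul]
    exact hx.comp hy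

/-- (Ported verbatim from the HodgeCMPerL package; no docstring in the source.) -/
theorem psGenAut_center (g : PsGen) (z : Circle) : psGenAut m hm g (center z : Heis V) = center z := by
  cases g with
  | weyl => rw [psGenAut_weyl, weylAut_apply, weyl_center]
  | unip => rw [psGenAut_unip, unip_center]

/-- Every `ψ_g` fixes the centre pointwise. -/
theorem psAction_center (g : FreeGroup PsGen) (z : Circle) : psAction m hm g (center z : Heis V) = center z := by
  induction g using FreeGroup.induction_on with
  | C1 => rw [map_one, MulAut.one_apply]
  | of x => rw [psAction_of, psGenAut_center]
  | inv_of x _ =>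
    rw [map_inv, psAction_of, MulAut.inv_apply]
    exact (MulEquiv.symm_apply_eq _).mpr (psGenAut_center m hm x z).symm
  | mul x y hx hy => rw [map_mul, MulAut.mul_apply, hy, hx]

end Heis

/-- `HeisP V m = Heis V ⋊_ψ F⟨σ,u⟩`. -/
abbrev HeisP (V : Type*) [NormedAddCommGroup V] [InnerProductSpace ℝ V] (m : ℤ) (hm : m ≠ 0) : Type _ :=
  Heis V ⋊[Heis.psAction m hm] FreeGroup PsGen

/-- (Ported verbatim from the HodgeCMPerL package; no docstring in the source.) -/
instance instIsTopologicalGroupHeisP (V : Type*) [NormedAddCommGroup V] [InnerProductSpace ℝ V] (m : ℤ)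
    (hm : m ≠ 0) : IsTopologicalGroup (HeisP V m hm) :=
  HeisSD.isTopologicalGroup (Heis.continuous_psAction m hm)

/-! ## 3. The operators `π : F⟨σ,u⟩ →* End(𝓢(V, ℂ))ˣ`, `σ ↦ 𝓕`, `u ↦ T_m` -/

section Units

variable (V : Type*) [NormedAddCommGroup V] [InnerProductSpace ℝ V]

/-- The chirp `T_c` as a unit of `End(𝓢(V, ℂ))`. -/
def chirpUnit (c : ℝ) : (𝓢(V, ℂ) →L[ℂ] 𝓢(V, ℂ))ˣ := (chirpEquiv V c).toUnit

/-- (Ported verbatim from the HodgeCMPerL package; no docstring in the source.) -/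
@[simp] theorem chirpUnit_apply (c : ℝ) (Φ : 𝓢(V, ℂ)) :
    (chirpUnit V c : 𝓢(V, ℂ) →L[ℂ] 𝓢(V, ℂ)) Φ = chirpCLM V c Φ := rfl

/-- (Ported verbatim from the HodgeCMPerL package; no docstring in the source.) -/
@[simp] theorem chirpUnit_inv_apply (c : ℝ) (Φ : 𝓢(V, ℂ)) :
    (((chirpUnit V c)⁻¹ : (𝓢(V, ℂ) →L[ℂ] 𝓢(V, ℂ))ˣ) : 𝓢(V, ℂ) →L[ℂ] 𝓢(V, ℂ)) Φ = chirpCLM V (-c) Φ := rfl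

end Units

section Rep

variable (V : Type) [NormedAddCommGroup V] [InnerProductSpace ℝ V] [FiniteDimensional ℝ V] [MeasurableSpace V]
  [BorelSpace V] (m : ℤ)

/-- The generators act on `𝓢(V, ℂ)` by `σ ↦ 𝓕`, `u ↦ T_m`. -/
def psGenUnit : PsGen → (𝓢(V, ℂ) →L[ℂ] 𝓢(V, ℂ))ˣ
  | .weyl => fourierUnit V
  | .unip => chirpUnit V m

/-- (Ported verbatim from the HodgeCMPerL package; no docstring in the source.) -/
@[simp] theorem psGenUnit_weyl : psGenUnit V m PsGen.weyl = fourierUnit V := rfl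

/-- (Ported verbatim from the HodgeCMPerL package; no docstring in the source.) -/
@[simp] theorem psGenUnit_unip : psGenUnit V m PsGen.unip = chirpUnit V m := rfl

/-- **`π : FreeGroup PsGen →* End(𝓢(V, ℂ))ˣ`**. -/
def psRep : FreeGroup PsGen →* (𝓢(V, ℂ) →L[ℂ] 𝓢(V, ℂ))ˣ := FreeGroup.lift (psGenUnit V m)

/-- (Ported verbatim from the HodgeCMPerL package; no docstring in the source.) -/
@[simp] theorem psRep_of (g : PsGen) : psRep V m (FreeGroup.of g) = psGenUnit V m g := FreeGroup.lift_apply_of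

/-- (Ported verbatim from the HodgeCMPerL package; no docstring in the source.) -/
theorem psRep_weyl_apply (Φ : 𝓢(V, ℂ)) :
    (psRep V m (FreeGroup.of PsGen.weyl) : 𝓢(V, ℂ) →L[ℂ] 𝓢(V, ℂ)) Φ = 𝓕 Φ := by
  rw [psRep_of, psGenUnit_weyl, fourierUnit_apply]

/-- (Ported verbatim from the HodgeCMPerL package; no docstring in the source.) -/
theorem psRep_unip_apply (Φ : 𝓢(V, ℂ)) :
    (psRep V m (FreeGroup.of PsGen.unip) : 𝓢(V, ℂ) →L[ℂ] 𝓢(V, ℂ)) Φ = chirpCLM V m Φ := by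
  rw [psRep_of, psGenUnit_unip, chirpUnit_apply]

variable (hm : m ≠ 0)

/-- The conjugation identity on the generators: `ρ_m(σh) = 𝓕 ρ_m(h) 𝓕⁻¹` (#6) and
`ρ_m(u_2 h) = T_m ρ_m(h) T_{-m}` (#10). -/
theorem repUnits_psGenAut (g : PsGen) (h : Heis V) :
    repUnits V m (Heis.psGenAut m hm g h) = psGenUnit V m g * repUnits V m h * (psGenUnit V m g)⁻¹ := by
  refine Units.ext (ContinuousLinearMap.ext fun Φ => ?_)
  cases g with
  | weyl =>
    rw [Heis.psGenAut_weyl, psGenUnit_weyl, Units.val_mul, Units.val_mul, val_repUnits, val_repUnits,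
      mul_apply_eq_comp, mul_apply_eq_comp, fourierUnit_apply, fourierUnit_inv_apply, Heis.weylAut_apply,
      fourier_repCLM V m hm, FourierTransform.fourier_fourierInv_eq]
  | unip =>
    rw [Heis.psGenAut_unip, psGenUnit_unip, Units.val_mul, Units.val_mul, val_repUnits, val_repUnits,
      mul_apply_eq_comp, mul_apply_eq_comp, chirpUnit_apply, chirpUnit_inv_apply,
      chirpCLM_int_repCLM_chirpCLM_neg]

/-- **`ρ_m(ψ_g h) = π_g ρ_m(h) π_g⁻¹` on the whole free group.** -/
theorem intertwines_psRep : Intertwines V m (Heis.psAction m hm) (psRep V m) := by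
  intro g
  induction g using FreeGroup.induction_on with
  | C1 =>
    intro h
    rw [map_one, map_one, MulAut.one_apply, inv_one, one_mul, mul_one]
  | of x =>
    intro h
    rw [Heis.psAction_of, psRep_of]
    exact repUnits_psGenAut V m hm x h
  | inv_of x hx =>
    intro h
    rw [map_inv, map_inv, Heis.psAction_of, psRep_of, inv_inv]
    have h1 := hx ((Heis.psGenAut m hm x)⁻¹ h)
    rw [Heis.psAction_of, psRep_of, MulAut.apply_inv_self] at h1
    rw [h1]
    group
  | mul x y hx hy =>
    intro h
    rw [map_mul, map_mul, MulAut.mul_apply, hx, hy, mul_inv_rev]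
    simp only [mul_assoc]

/-- **`ρ̃ : HeisP V m →* End(𝓢(V, ℂ))ˣ`**, `(h, g) ↦ ρ_m(h) π_g`. -/
def repP : HeisP V m hm →* (𝓢(V, ℂ) →L[ℂ] 𝓢(V, ℂ))ˣ := repSD V m (intertwines_psRep V m hm)

/-- (Ported verbatim from the HodgeCMPerL package; no docstring in the source.) -/
theorem repP_def : repP V m hm = repSD V m (intertwines_psRep V m hm) := rfl

/-- (Ported verbatim from the HodgeCMPerL package; no docstring in the source.) -/
@[simp] theorem repP_inl_apply (h : Heis V) (Φ : 𝓢(V, ℂ)) :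
    (repP V m hm (SemidirectProduct.inl h) : 𝓢(V, ℂ) →L[ℂ] 𝓢(V, ℂ)) Φ = repCLM V m h Φ :=
  repSD_inl_apply V m (intertwines_psRep V m hm) h Φ

/-- **The adjoined Weyl element acts by the Fourier transform.** -/
@[simp] theorem repP_weyl_apply (Φ : 𝓢(V, ℂ)) :
    (repP V m hm (SemidirectProduct.inr (FreeGroup.of PsGen.weyl)) : 𝓢(V, ℂ) →L[ℂ] 𝓢(V, ℂ)) Φ = 𝓕 Φ := by
  rw [repP_def, repSD_inr, psRep_weyl_apply]

/-- **The adjoined unipotent acts by the chirp `T_m`.** -/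
@[simp] theorem repP_unip_apply (Φ : 𝓢(V, ℂ)) :
    (repP V m hm (SemidirectProduct.inr (FreeGroup.of PsGen.unip)) : 𝓢(V, ℂ) →L[ℂ] 𝓢(V, ℂ)) Φ =
      chirpCLM V m Φ := by
  rw [repP_def, repSD_inr, psRep_unip_apply]

/-- Joint continuity of `(x, Φ) ↦ ρ̃(x)Φ`. -/
theorem continuous_repP_uncurry :
    Continuous fun p : HeisP V m hm × 𝓢(V, ℂ) => (repP V m hm p.1 : 𝓢(V, ℂ) →L[ℂ] 𝓢(V, ℂ)) p.2 :=
  continuous_repSD_uncurry V m (intertwines_psRep V m hm)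

end Rep

/-! ## 4. Theta invariance and arithmeticity for a self-dual lattice -/

section SelfDual

variable (V : Type) [NormedAddCommGroup V] [InnerProductSpace ℝ V] [FiniteDimensional ℝ V] [MeasurableSpace V]
  [BorelSpace V] (L : Submodule ℤ V) [DiscreteTopology L] [IsZLattice ℝ L] (m : ℤ)

/-- **`Σ_{v ∈ L} (π_g Ψ)(v) = Σ_{v ∈ L} Ψ(v)`** for `L = L*`: Poisson summation for `σ`, integrality of
`m‖v‖²` for `u`, and induction on the free group. -/
theorem fixesTheta_psRep (hL : PoissonSummation.dualLattice L = L) : FixesTheta V L m (psRep V m) := by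
  intro g
  induction g using FreeGroup.induction_on with
  | C1 =>
    intro Ψ
    rw [map_one, Units.val_one, one_apply_eq_self]
  | of x =>
    intro Ψ
    cases x with
    | weyl =>
      rw [psRep_weyl_apply, thetaH_one, thetaH_one]
      exact PoissonSummation.tsum_fourier_eq_tsum_of_dualLattice_eq L Ψ hL
    | unip =>
      rw [psRep_unip_apply]
      exact thetaH_chirpCLM_one_of_le V L m (le_of_eq hL.symm) m Ψ
  | inv_of x hx =>
    intro Ψ
    have h1 := hx ((((psRep V m (FreeGroup.of x))⁻¹ : (𝓢(V, ℂ) →L[ℂ] 𝓢(V, ℂ))ˣ) : 𝓢(V, ℂ) →L[ℂ] 𝓢(V, ℂ)) Ψ)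
    rw [units_apply_inv_apply] at h1
    rw [map_inv]
    exact h1.symm
  | mul x y hx hy =>
    intro Ψ
    rw [map_mul, Units.val_mul, mul_apply_eq_comp, hx, hy]

omit [MeasurableSpace V] [BorelSpace V] in
/-- The generators preserve `arith(L, m)` for `L = L*`, in the form of an `iff`. -/
theorem mem_arith_iff_psGenAut_mem (hL : PoissonSummation.dualLattice L = L) (hm : m ≠ 0) (g : PsGen) (h : Heis V) :
    h ∈ arith V L m ↔ Heis.psGenAut m hm g h ∈ arith V L m := by
  cases g with
  | weyl =>
    rw [Heis.psGenAut_weyl, Heis.weylAut_apply]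
    refine ⟨weyl_mem_arith_of_dualLattice_eq V L m hL hm, fun hw => ?_⟩
    have h3 := weyl_mem_arith_of_dualLattice_eq V L m hL hm
      (weyl_mem_arith_of_dualLattice_eq V L m hL hm (weyl_mem_arith_of_dualLattice_eq V L m hL hm hw))
    rwa [Heis.weyl_weyl_weyl_weyl] at h3
  | unip =>
    rw [Heis.psGenAut_unip]
    have hL' : L ≤ PoissonSummation.dualLattice L := le_of_eq hL.symm
    refine ⟨fun hh => ?_, fun hu => ?_⟩
    · have h1 := unip_mem_arith V L m hL' 1 hh
      rwa [Int.cast_one, mul_one] at h1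
    · have h1 := unip_mem_arith V L m hL' (-1) hu
      rwa [← MulAut.mul_apply, ← Heis.unip_add, Int.cast_neg, Int.cast_one, mul_neg, mul_one, neg_add_cancel,
        Heis.unip_zero, MulAut.one_apply] at h1

omit [MeasurableSpace V] [BorelSpace V] in
/-- (Ported verbatim from the HodgeCMPerL package; no docstring in the source.) -/
theorem mem_arith_iff_psAction_mem (hL : PoissonSummation.dualLattice L = L) (hm : m ≠ 0) (g : FreeGroup PsGen)
    (h : Heis V) : h ∈ arith V L m ↔ Heis.psAction m hm g h ∈ arith V L m := by
  induction g using FreeGroup.induction_on generalizing h with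
  | C1 => rw [map_one, MulAut.one_apply]
  | of x =>
    rw [Heis.psAction_of]
    exact mem_arith_iff_psGenAut_mem V L m hL hm x h
  | inv_of x hx =>
    rw [map_inv, Heis.psAction_of]
    have h1 := hx ((Heis.psGenAut m hm x)⁻¹ h)
    rw [Heis.psAction_of, MulAut.apply_inv_self] at h1
    exact h1.symm
  | mul x y hx hy =>
    rw [map_mul, MulAut.mul_apply]
    exact (hy h).trans (hx _)

omit [MeasurableSpace V] [BorelSpace V] in
/-- **`ψ_g(arith) ⊆ arith`** for `L = L*`. -/
theorem preservesArith_psAction (hL : PoissonSummation.dualLattice L = L) (hm : m ≠ 0) :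
    PreservesArith V L m (Heis.psAction m hm) :=
  fun g _ hh => (mem_arith_iff_psAction_mem V L m hL hm g _).mp hh

/-- `arithP = ⟨arith(L, m), σ, u⟩ ≤ HeisP V m`. -/
abbrev arithP (hm : m ≠ 0) : Subgroup (HeisP V m hm) := arithSD V L m (Heis.psAction m hm)

/-! ## 5. The model -/


-- port_pkg: scope closed for this part
end SelfDual
end SchwartzWeil
end HodgeCM
end
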